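import Summits.Schanuel.Schanuel.Theorems.RootDecomp1BAlgFrame03

/-!
# RootDecomp1BAlgFrame — lens 4, generation 40 «UNBOUNDED-DEGREE FRAMES» (lane B-R24 (b′), PRICE B-β, RULE B-R26): X(2) and the three At-cells at (1 | ρ) for every ρ in the class `AlgUltraLiouville` (doubly-exponential hyper-approximation by real algebraic irrationals of UNBOUNDED degree) modulo `Roy2014_thm_1_1` ONLY — the degree a running parameter of Roy's point-explicit L–W measure (budget lemma `algFrameMeasure_explicit_of_roy` with the floor exp(−royC D·exp(A^8)·(1+log H)) in its TYPE); the NAMED MEMBER ρ_A (a tower over 2^{1/p}, prime degrees p → ∞) with HYPOTHESIS-FREE membership, degree certificate [ℚ(β_K):ℚ] = g_K, position certificate |ρ_A − γ| ≥ exp(−A⁴) and the exclusions BY TREE NAMES (¬Hyper, ¬QuadHyper, ¬Ultra ×2, ¬LiouvilleOrder 8, transcendental) — continuation (RootDecomp1BAlgFrame04): §M.1–§M.3 prime degrees, radicals, frame data, growth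

(lens-4 g40 HOME kernel AlgFrame.lean fe3f4606…, 1974 l, imports tree RootDecomp1BQuadFrame05 + RootDecomp1EPointTransfer04 only; CLAIM L2078, RULING + CHECKLIST B-g40 L2080, NODE L2101 / REQUEST L2102 / RESULT L2103, critic VERDICT L2111 (crit g9: (A) CLEARED — ONE CELL (B-β); lens-4 tally THEOREM ×6 + CELL ×3; RULE B-R26 in force (the Roy-transfer line on 1B CLOSED); PORT GO 01–09 `--supports stmt-Schanuel-24622`); port by census-1 gen 18 as `RootDecomp1BAlgFrame01`–`09` along K's sections: 01 = §D the class `AlgUltraLiouville` + the measure shape `AlgFrameMeasure` + §R helpers (`royC`); 02 = §R the budget lemma `algFrameMeasure_explicit_of_roy` (Roy ⟹ the algebraic frame measure in EVERY degree; scoped `maxHeartbeats 1600000` carried as in K); 03 = §E the engine `algebraicIndependent_exp_frame_of_algUltraLiouville (hRoy)` + the `![…]` forms; 04 = §M.1–§M.3 prime degrees `gdeg`, radicals `theta`, frame data `Nseq`/`Pseq`/`fd` (with `attribute [irreducible] fd`), `betaSeq`, `fSeq`, `ASeq`, growth; 05 = §M.4–§M.5 increments, the limit `rhoA`, MEMBERSHIP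 `algUltraLiouville_rhoA`; 06 = §M.6–§M.7 degree certificate `finrank_adjoin_theta` / `adjoin_betaSeq_eq` + the number-field Liouville inequality (`FK`, `thetaF`, `sigma0`, norm to ℚ); 07 = §M.8–§M.9 the frame bound, the tower inequality, scale selection, `cert_arith`; 08 = §M.10–§M.11 THE POSITION CERTIFICATE `rhoA_far_from_degree_le` + EXCLUSIONS by tree names (`not_hyperLiouville_rhoA`, `not_quadHyperLiouville_rhoA`, `not_ultraLiouville_rhoA` / `'`, `not_liouvilleOrder_rhoA`, `transcendental_rhoA`); 09 = §C the cells `four_le_polarDeg_one_of_algUltra (hRoy)` (+ swap), the At-cells, the member cells at ρ_A, `rhoA_position`.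
PORT EDITS: the three `set_option linter.*` lines dropped and the one surfaced `unnecessarySimpa` fixed (`simpa using h12` ↦ `simp`, §R); 74 one-line docstrings added; two generic helpers made `private` (`three_mul_le_two_pow`, `half_identity`) with per-part private copies of those and of K's own private helpers; statements and proofs verbatim. `--supports stmt-Schanuel-24622`; no census credit carried; rung 0 — nothing here proves Schanuel.)
-/

noncomputable section

open Complex IntermediateField MvPolynomial

namespace Summit.Schanuel.Schanuel.Theorems.RootDecomp1BAlgFrame

open Summit.Schanuel.Schanuel.Theorems.RootDecomp1EPointTransfer (Roy2014_thm_1_1)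
open Summit.Schanuel.Schanuel.Theorems.RootDecomp1KHyper (mvlen mvlen_nonneg abs_coeff_le_mvlen one_le_mvlen)
open Summit.Schanuel.Schanuel.Theorems.RootDecomp1BHyperFrame (royDeg royS RoyNF roy_tree_iff framePt Ff
  Ff_eq_aeval exists_lipschitz_Ff linearIndependent_one_irrational)
open Summit.Schanuel.Schanuel.Theorems.RootDecomp1BQuadFrame (qy qe qpt qpt_apply framePt_qy_qe linearIndependent_qpt
  QuadHyperLiouville)
open Summit.Schanuel.Schanuel.Theorems.RootDecomp1BFedFlagCore (KleinIH polarDeg polarField)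
open Summit.Schanuel.Schanuel.Theorems.RootDecomp1BDefectFloorDefs (SharpRelativeLindemannAt TameDefectZeroAt
  WildSharpDefectZeroAt WildSharpDefectZeroInitAt WildSharpInitAt)
open Summit.Schanuel.Schanuel.Theorems.RootDecomp1BDefectFloorCells (natCast_le_trdeg_of_algebraicIndependent)
open Summit.Schanuel.Schanuel.Theorems.RootDecomp1BRadicalDescent (exists_int_relation)
open Summit.Schanuel.Schanuel.Theorems.RootDecomp1BMovingZero (mem_polarField_one mem_polarField_swap)

/-! ## §M  The member `rhoA`: a tower over `2^{1/p}`, prime degrees `p → ∞` (hypothesis-free)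

`rhoA = lim β_K`, `β_K = (P_K + 2^{1/g_K}) / 2^{N_K}` with `g_K` prime, `K + 3 < g_K ≤ 2(K + 3)` (Bertrand),
`P_{K+1} = ⌊2^{N_{K+1}} β_K⌋`, `N_{K+1} = 2·3^{A_K^{K+1}} + 2`, `A_K` the explicit data bound of
`f_K = (2^{N_K} X − P_K)^{g_K} − 2 ∈ ℤ[X]` (root `β_K`). -/

section Member

/-! ### §M.1 prime degrees and the radicals `θ_K = 2^{1/g_K}` -/

/-- Bertrand: a prime `p` with `K + 3 < p ≤ 2(K+3)`. -/
theorem exists_gdeg (K : ℕ) : ∃ p, Nat.Prime p ∧ K + 3 < p ∧ p ≤ 2 * (K + 3) :=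
  Nat.exists_prime_lt_and_le_two_mul (K + 3) (by omega)

/-- The degree ladder: a prime `g_K` with `K + 3 < g_K ≤ 2 (K + 3)`. -/
def gdeg (K : ℕ) : ℕ := Classical.choose (exists_gdeg K)

/-- `g_K` is prime. -/
theorem gdeg_prime (K : ℕ) : (gdeg K).Prime := (Classical.choose_spec (exists_gdeg K)).1

/-- `K + 3 < g_K`. -/
theorem lt_gdeg (K : ℕ) : K + 3 < gdeg K := (Classical.choose_spec (exists_gdeg K)).2.1

/-- `g_K ≤ 2(K+3)`. -/
theorem gdeg_le (K : ℕ) : gdeg K ≤ 2 * (K + 3) := (Classical.choose_spec (exists_gdeg K)).2.2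

/-- `0 < g_K`. -/
theorem gdeg_pos (K : ℕ) : 0 < gdeg K := lt_of_le_of_lt (Nat.zero_le _) (lt_gdeg K)

/-- `g_K ≠ 0`. -/
theorem gdeg_ne_zero (K : ℕ) : gdeg K ≠ 0 := (gdeg_pos K).ne'

/-- `θ_K = 2^{1/g_K}`. -/
def theta (K : ℕ) : ℝ := (2 : ℝ) ^ ((gdeg K : ℝ)⁻¹)

/-- `θ_K ^ g_K = 2`. -/
theorem theta_pow (K : ℕ) : theta K ^ gdeg K = 2 :=
  Real.rpow_inv_natCast_pow (by norm_num) (gdeg_ne_zero K)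

/-- `1 < θ_K`. -/
theorem one_lt_theta (K : ℕ) : 1 < theta K :=
  Real.one_lt_rpow (by norm_num) (inv_pos.mpr (by exact_mod_cast gdeg_pos K))

/-- `θ_K < 2`. -/
theorem theta_lt_two (K : ℕ) : theta K < 2 := by
  have h : ((gdeg K : ℝ)⁻¹) < 1 := by
    have h3 : (3 : ℝ) < gdeg K := by exact_mod_cast lt_of_le_of_lt (Nat.le_add_left 3 K) (lt_gdeg K)
    exact inv_lt_one_of_one_lt₀ (by linarith)
  have := Real.rpow_lt_rpow_of_exponent_lt (by norm_num : (1 : ℝ) < 2) h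
  simpa [theta] using this

/-- `0 < θ_K`. -/
theorem theta_pos (K : ℕ) : 0 < theta K := lt_trans zero_lt_one (one_lt_theta K)

/-- `θ_K = 2^{1/g_K}` is irrational. -/
theorem irrational_theta (K : ℕ) : Irrational (theta K) := by
  refine irrational_nrt_of_notint_nrt (gdeg K) 2 (by rw [theta_pow]; norm_num) ?_ (gdeg_pos K)
  rintro ⟨y, hy⟩
  have h1 := one_lt_theta K
  have h2 := theta_lt_two K
  rw [hy] at h1 h2
  have h1' : (1 : ℤ) < y := by exact_mod_cast h1
  have h2' : y < (2 : ℤ) := by exact_mod_cast h2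
  omega

/-! ### §M.2 the frame data `(N_K, P_K)` and the frames `β_K`, `f_K`, `A_K` -/

/-- `β(K; N, P) = (P + θ_K) / 2^N`. -/
def betaOf (K N P : ℕ) : ℝ := ((P : ℝ) + theta K) / ((2 ^ N : ℕ) : ℝ)

/-- `f(K; N, P) = (2^N X − P)^{g_K} − 2 ∈ ℤ[X]`. -/
def fOf (K N P : ℕ) : Polynomial ℤ :=
  (Polynomial.C ((2 ^ N : ℕ) : ℤ) * Polynomial.X - Polynomial.C (P : ℤ)) ^ gdeg K - Polynomial.C 2

/-- The explicit data bound `A(K; N, P) = K + g_K + (2^N)^{g_K} + Σ_i |coeff_i f|`. -/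
def AOf (K N P : ℕ) : ℕ :=
  K + gdeg K + (2 ^ N) ^ gdeg K + ∑ i ∈ (fOf K N P).support, ((fOf K N P).coeff i).natAbs

/-- The next exponent `N' = 2 · 3^{A^{K+1}} + 2`. -/
def nextN (K N P : ℕ) : ℕ := 2 * 3 ^ (AOf K N P ^ (K + 1)) + 2

/-- The frame data `(N_K, P_K)`: `N_0 = 10`, `P_0 = 0`; `N_{K+1} = nextN`, `P_{K+1} = ⌊2^{N_{K+1}} β_K⌋`. -/
def fd : ℕ → ℕ × ℕ
  | 0 => (10, 0)
  | K + 1 => (nextN K (fd K).1 (fd K).2,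
      ⌊(((2 ^ nextN K (fd K).1 (fd K).2 : ℕ) : ℝ)) * betaOf K (fd K).1 (fd K).2⌋₊)

/-- `N_K`. -/
def Nseq (K : ℕ) : ℕ := (fd K).1

/-- `P_K`. -/
def Pseq (K : ℕ) : ℕ := (fd K).2

/-- `a_K = 2^{N_K}`. -/
def aN (K : ℕ) : ℕ := 2 ^ Nseq K

/-- `β_K`. -/
def betaSeq (K : ℕ) : ℝ := betaOf K (Nseq K) (Pseq K)

/-- `f_K`. -/
def fSeq (K : ℕ) : Polynomial ℤ := fOf K (Nseq K) (Pseq K)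

/-- `A_K`. -/
def ASeq (K : ℕ) : ℕ := AOf K (Nseq K) (Pseq K)

/-- `N_0 = 10`. -/
theorem Nseq_zero : Nseq 0 = 10 := rfl

/-- `P_0 = 0`. -/
theorem Pseq_zero : Pseq 0 = 0 := rfl

/-- The recursion for `N_{K+1}`. -/
theorem Nseq_succ (K : ℕ) : Nseq (K + 1) = 2 * 3 ^ (ASeq K ^ (K + 1)) + 2 := rfl

/-- The recursion for `P_{K+1}`. -/
theorem Pseq_succ (K : ℕ) : Pseq (K + 1) = ⌊((aN (K + 1) : ℕ) : ℝ) * betaSeq K⌋₊ := rfl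

/- The recursion `fd` is a TOWER: never let `whnf` unfold it numerically (all later uses go through the four
equations above). -/
attribute [irreducible] fd

/-- `0 < a_K = 2^{N_K}`. -/
theorem aN_pos (K : ℕ) : 0 < aN K := by unfold aN; positivity

/-- `0 < a_K` in `ℝ`. -/
theorem aNR_pos (K : ℕ) : (0 : ℝ) < aN K := by exact_mod_cast aN_pos K

/-- `β_K = (P_K + θ_K)/a_K`. -/
theorem betaSeq_def (K : ℕ) : betaSeq K = ((Pseq K : ℝ) + theta K) / (aN K : ℝ) := by
  simp only [betaSeq, betaOf, aN]

/-- `a_K β_K = P_K + θ_K`. -/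
theorem aN_mul_betaSeq (K : ℕ) : (aN K : ℝ) * betaSeq K = Pseq K + theta K := by
  rw [betaSeq_def, mul_div_cancel₀ _ (aNR_pos K).ne']

/-- `β_K` is irrational. -/
theorem irrational_betaSeq (K : ℕ) : Irrational (betaSeq K) := by
  rw [betaSeq_def]
  exact ((irrational_theta K).natCast_add (Pseq K)).div_natCast (aN_pos K).ne'

/-- `f_K(β_K) = 0`. -/
theorem aeval_betaSeq_fSeq (K : ℕ) : Polynomial.aeval (betaSeq K) (fSeq K) = 0 := by
  have h : ((2 ^ Nseq K : ℕ) : ℝ) * betaSeq K - (Pseq K : ℝ) = theta K := by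
    have := aN_mul_betaSeq K; unfold aN at this; linarith
  unfold fSeq fOf
  rw [map_sub, map_pow, map_sub, map_mul, Polynomial.aeval_X, Polynomial.aeval_C, Polynomial.aeval_C,
    Polynomial.aeval_C]
  simp only [eq_intCast, Int.cast_natCast, Int.cast_ofNat]
  rw [h, theta_pow, sub_self]

/-- `f_K ≠ 0` (its value at `P_K / a_K` is `−2`). -/
theorem fSeq_ne_zero (K : ℕ) : fSeq K ≠ 0 := by
  intro h0
  have h : Polynomial.aeval ((Pseq K : ℝ) / (aN K : ℝ)) (fSeq K) = 0 := by rw [h0, map_zero]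
  unfold fSeq fOf at h
  rw [map_sub, map_pow, map_sub, map_mul, Polynomial.aeval_X, Polynomial.aeval_C, Polynomial.aeval_C,
    Polynomial.aeval_C] at h
  simp only [eq_intCast, Int.cast_natCast, Int.cast_ofNat] at h
  have h2 : ((2 ^ Nseq K : ℕ) : ℝ) * ((Pseq K : ℝ) / (aN K : ℝ)) - (Pseq K : ℝ) = 0 := by
    have ha := (aNR_pos K).ne'
    unfold aN at ha ⊢
    rw [mul_div_cancel₀ _ ha]; ring
  rw [h2, zero_pow (gdeg_ne_zero K), zero_sub, neg_eq_zero] at h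
  norm_num at h

/-- `natDegree f_K ≤ g_K`. -/
theorem natDegree_fSeq_le (K : ℕ) : (fSeq K).natDegree ≤ gdeg K := by
  unfold fSeq fOf
  refine (Polynomial.natDegree_sub_le _ _).trans ?_
  rw [Polynomial.natDegree_C, max_eq_left (Nat.zero_le _)]
  refine Polynomial.natDegree_pow_le.trans ?_
  have h : (Polynomial.C ((2 ^ Nseq K : ℕ) : ℤ) * Polynomial.X - Polynomial.C (Pseq K : ℤ)).natDegree ≤ 1 := by
    refine (Polynomial.natDegree_sub_le _ _).trans ?_
    rw [Polynomial.natDegree_C]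
    refine max_le ?_ (Nat.zero_le _)
    exact (Polynomial.natDegree_C_mul_le _ _).trans Polynomial.natDegree_X_le
  calc gdeg K * _ ≤ gdeg K * 1 := Nat.mul_le_mul_left _ h
    _ = gdeg K := mul_one _

/-- `g_K ≤ A_K`. -/
theorem gdeg_le_ASeq (K : ℕ) : gdeg K ≤ ASeq K := by unfold ASeq AOf; omega

/-- `K ≤ A_K`. -/
theorem le_ASeq (K : ℕ) : K ≤ ASeq K := by unfold ASeq AOf; omega

/-- `a_K ^ g_K ≤ A_K`. -/
theorem aN_pow_le_ASeq (K : ℕ) : aN K ^ gdeg K ≤ ASeq K := by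
  unfold ASeq AOf aN; omega

/-- `a_K ≤ A_K`. -/
theorem aN_le_ASeq (K : ℕ) : aN K ≤ ASeq K := by
  refine le_trans ?_ (aN_pow_le_ASeq K)
  calc aN K = aN K ^ 1 := (pow_one _).symm
    _ ≤ aN K ^ gdeg K := Nat.pow_le_pow_right (aN_pos K) (gdeg_pos K)

/-- `1 ≤ A_K`. -/
theorem one_le_ASeq (K : ℕ) : 1 ≤ ASeq K := le_trans (aN_pos K) (aN_le_ASeq K)

/-- `natDegree f_K ≤ A_K`. -/
theorem natDegree_fSeq_le_ASeq (K : ℕ) : (fSeq K).natDegree ≤ ASeq K :=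
  (natDegree_fSeq_le K).trans (gdeg_le_ASeq K)

/-- The coefficient bound `|coeff_i f_K| ≤ A_K`. -/
theorem abs_coeff_fSeq_le (K : ℕ) (i : ℕ) : |(fSeq K).coeff i| ≤ (ASeq K : ℤ) := by
  classical
  by_cases hi : i ∈ (fSeq K).support
  · have h1 : ((fSeq K).coeff i).natAbs ≤ ∑ j ∈ (fSeq K).support, ((fSeq K).coeff j).natAbs :=
      Finset.single_le_sum (f := fun j => ((fSeq K).coeff j).natAbs) (fun j _ => Nat.zero_le _) hi
    have h2 : ∑ j ∈ (fSeq K).support, ((fSeq K).coeff j).natAbs ≤ ASeq K := by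
      unfold ASeq AOf fSeq; omega
    calc |(fSeq K).coeff i| = (((fSeq K).coeff i).natAbs : ℤ) := (Int.natCast_natAbs _).symm
      _ ≤ (ASeq K : ℤ) := by exact_mod_cast h1.trans h2
  · rw [Polynomial.notMem_support_iff.mp hi, abs_zero]; positivity

/-! ### §M.3 growth of the exponents `N_K` -/

/-- `2·3^{A_K} + 2 ≤ N_{K+1}`. -/
theorem Nseq_succ_ge (K : ℕ) : 2 * 3 ^ ASeq K + 2 ≤ Nseq (K + 1) := by
  rw [Nseq_succ]
  have h : ASeq K ≤ ASeq K ^ (K + 1) := by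
    calc ASeq K = ASeq K ^ 1 := (pow_one _).symm
      _ ≤ ASeq K ^ (K + 1) := Nat.pow_le_pow_right (one_le_ASeq K) (by omega)
  have := Nat.pow_le_pow_right (by norm_num : 1 ≤ 3) h
  omega

/-- `N_K < a_K`. -/
theorem Nseq_lt_aN (K : ℕ) : Nseq K < aN K := by unfold aN; exact Nat.lt_two_pow_self

/-- `N_K < A_K`. -/
theorem Nseq_lt_ASeq (K : ℕ) : Nseq K < ASeq K := (Nseq_lt_aN K).trans_le (aN_le_ASeq K)

/-- `N_K < N_{K+1}` (room to spare). -/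
theorem Nseq_lt_succ (K : ℕ) : Nseq K < Nseq (K + 1) := by
  have h1 := Nseq_succ_ge K
  have h2 := Nseq_lt_ASeq K
  have h3 : ASeq K < 3 ^ ASeq K := Nat.lt_pow_self (by norm_num)
  omega

/-- `N` is strictly increasing. -/
theorem Nseq_strictMono : StrictMono Nseq := strictMono_nat_of_lt_succ Nseq_lt_succ

/-- `K + 10 ≤ N_K`. -/
theorem le_Nseq (K : ℕ) : K + 10 ≤ Nseq K := by
  induction K with
  | zero => simp [Nseq_zero]
  | succ n ih => have := Nseq_lt_succ n; omega

/-- `N_K + j ≤ N_{j+K}`. -/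
theorem Nseq_add_le (K j : ℕ) : Nseq K + j ≤ Nseq (j + K) := by
  induction j with
  | zero => simp
  | succ j ih =>
    have := Nseq_lt_succ (j + K)
    rw [show j + 1 + K = j + K + 1 by omega]; omega

/-- `a_K = 2^{N_K}` in `ℝ`. -/
theorem aNR_eq (K : ℕ) : (aN K : ℝ) = (2 : ℝ) ^ Nseq K := by unfold aN; push_cast; rfl

/-- `2 a_K ≤ a_{K+1}`. -/
theorem aN_succ_ge (K : ℕ) : 2 * aN K ≤ aN (K + 1) := by
  unfold aN
  have := Nseq_lt_succ K
  calc 2 * 2 ^ Nseq K = 2 ^ (Nseq K + 1) := by ring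
    _ ≤ 2 ^ Nseq (K + 1) := Nat.pow_le_pow_right (by norm_num) (by omega)

/-- `a` is strictly increasing. -/
theorem aN_strictMono : StrictMono aN :=
  strictMono_nat_of_lt_succ fun K => by have := aN_succ_ge K; have := aN_pos K; omega

/-- `a_0 = 1024`. -/
theorem aN_zero : aN 0 = 1024 := by simp [aN, Nseq_zero]

/-- `1024 ≤ a_K`. -/
theorem le_aN (K : ℕ) : 1024 ≤ aN K := by
  rw [← aN_zero]; exact aN_strictMono.monotone (Nat.zero_le K)

end Member

end Summit.Schanuel.Schanuel.Theorems.RootDecomp1BAlgFrame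

end
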